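import Literature.MathematicalPhysics.QuantumLattice.GrassmannCumulantKernelBoundPrescribed
import Literature.MathematicalPhysics.QuantumLattice.GrassmannGaussConvBinomialGram
import HarnessLib

/-!
# The linear part of the renormalisation-group map in binomial–Gram form with PRESCRIBED output legs

Topic `MathematicalPhysics/QuantumLattice`; the label-restricted twin of `GrassmannGaussConvBinomialGram`
(Benfatto–Giuliani–Mastropietro 2006, (2.61)–(2.63), (2.66), (2.77)–(2.80) with the sectorised bookkeeping of §2.4, Lemma 2.6; Gawȩdzki–
Kupiainen 1985, §3), obtained exactly as there: the first cumulant (`n = 1`) of the all-order prescribed bound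
`GrassmannCumulantKernelBoundPrescribed.sum_norm_kernel_cumulantOf_le_prescribed_of_gramBounded`, whose tree factor `1 + λ α (2m')²`
is sent to `1` by `λ → 0`.  At first order all the output legs are legs of the ONE input vertex, so the prescribed legs constrain
`|J|` of its legs and the pinned output leg pins one more: the vertex enters through `N(m', |J|)`.  One output label pinned, the output
labels of the slots `j ∈ J` constrained to `A j`, the others summed:

  `Σ_W ‖kernel_r (e^{Δ_C} H)(W)‖ ≤ Σ_{m' : r ≤ 2m'} (r!)⁻¹ (∏_{j∉J}(2m'-j)) (2m')^{|J|} κ^{2m'-r} N(m', |J|)`,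

and for `e^{Δ_C} H − H` in degree `2p` only `m' > p` contribute.  (The count `(r!)⁻¹ (∏_{j∉J}(2m'-j)) (2m')^{|J|}` replaces `C(2m', r)`.)

* (private) `prescribedBound_one` — the `n = 1` value of the prescribed bound;
* `sum_norm_kernel_gaussConv_le_binomial_prescribed_of_gramBounded`;
* **`sum_norm_kernel_gaussConv_sub_le_binomial_prescribed_of_gramBounded`**.

Everything is proved; no definition, no named fact.

## Sources

G. Benfatto, A. Giuliani, V. Mastropietro, Ann. Henri Poincaré 7 (2006) 809–898, (2.61)–(2.63), (2.66), (2.77)–(2.80), §2.4 Lemma 2.6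
[`BenfattoGiulianiMastropietro2006`]; K. Gawȩdzki, A. Kupiainen, Comm. Math. Phys. 102 (1985) 1–30, §3 [`GawedzkiKupiainen1985GrossNeveu`];
M. Salmhofer, *Renormalization* (1999), §4.3 (4.86)–(4.95) [`Salmhofer1999`].
-/

noncomputable section

namespace Literature.MathematicalPhysics.QuantumLattice

open GrassmannAlgebra Finset Literature.Probability.LatticeModels
open scoped Nat

universe u

variable {𝕜 : Type*} [RCLike 𝕜] {Γ : Type u} [Fintype Γ] [DecidableEq Γ] (C : Matrix Γ Γ 𝕜)

/-! ### The first cumulant of the prescribed bound -/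

/-- **The `n = 1` value of the prescribed cumulant bound**: one vertex of degree `2m'`, all constrained output slots land on it
(the unique profile), the tree factor is `1 + λ α (2m')²`. [folklore] -/
private theorem prescribedBound_one (κ α lam : ℝ) (N : ℕ → ℕ → ℝ) {r : ℕ} (J : Finset (Fin r)) (m' : ℕ) :
    ((((r.factorial : ℝ))⁻¹ *
          ((∏ j ∈ univ.filter (fun j : Fin r => j ∉ J), ((∑ a : Fin 1, 2 * (fun _ : Fin 1 => m') a) - (j : ℕ)) : ℕ) : ℝ)) *
        κ ^ ((∑ a : Fin 1, 2 * (fun _ : Fin 1 => m') a) - (r + 2 * (1 - 1))) *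
        ∑ pf : J → Fin 1, (∏ j, ((2 * (fun _ : Fin 1 => m') (pf j) : ℕ) : ℝ)) *
          ∏ a, N ((fun _ : Fin 1 => m') a) (univ.filter fun j : J => pf j = a).card) *
      ((lam)⁻¹ ^ (1 - 1) * ∏ ℓ : Sym2 (Fin 1), (1 + lam * (α * (pairDeg (fun a => 2 * (fun _ : Fin 1 => m') a) ℓ : ℝ)))) =
      (((r.factorial : ℝ))⁻¹ * ((∏ j ∈ univ.filter (fun j : Fin r => j ∉ J), (2 * m' - (j : ℕ)) : ℕ) : ℝ)) *
        ((2 * m' : ℕ) : ℝ) ^ J.card * κ ^ (2 * m' - r) * N m' J.card * (1 + lam * (α * ((2 * m') * (2 * m') : ℕ))) := by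
  have hsub : Subsingleton (Sym2 (Fin 1)) := ⟨by
    intro x y
    induction x using Sym2.ind with
    | _ a b =>
      induction y using Sym2.ind with
      | _ c d => rw [Subsingleton.elim a c, Subsingleton.elim b d]⟩
  have hprod : ∏ ℓ : Sym2 (Fin 1), (1 + lam * (α * (pairDeg (fun _ : Fin 1 => 2 * m') ℓ : ℝ))) =
      1 + lam * (α * ((2 * m') * (2 * m') : ℕ)) := by
    haveI := hsub
    set ℓ₀ : Sym2 (Fin 1) := Sym2.mk (0 : Fin 1) (0 : Fin 1) with hℓ₀
    have huniv : (univ : Finset (Sym2 (Fin 1))) = ({ℓ₀} : Finset (Sym2 (Fin 1))) :=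
      eq_singleton_iff_unique_mem.2 ⟨mem_univ ℓ₀, fun x _ => Subsingleton.elim x ℓ₀⟩
    rw [huniv, prod_singleton, hℓ₀]
    simp only [pairDeg, Sym2.lift_mk]
  -- the unique landing profile
  have hφsum : ∑ pf : J → Fin 1, (∏ j, ((2 * (fun _ : Fin 1 => m') (pf j) : ℕ) : ℝ)) *
        ∏ a, N ((fun _ : Fin 1 => m') a) (univ.filter fun j : J => pf j = a).card =
      ((2 * m' : ℕ) : ℝ) ^ J.card * N m' J.card := by
    rw [Fintype.sum_unique]
    dsimp only
    rw [prod_const, card_univ, Fintype.card_coe, Fin.prod_univ_one,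
      filter_true_of_mem fun j _ => Subsingleton.elim _ _, card_univ, Fintype.card_coe]
  simp only [Fin.sum_univ_one, Nat.sub_self, mul_zero, add_zero, pow_zero, one_mul]
  rw [hφsum, hprod]
  ring

/-! ### The linear part in binomial–Gram form with prescribed output legs -/

/-- **The Gaussian convolution in binomial–Gram form with prescribed output legs** (first cumulant of BGM 2006 (2.77)–(2.80) with
the sector bookkeeping of Lemma 2.6): `C` replica-Gram-bounded with constant `κ ≥ 0`, `H` even whose kernels have anchored norms with
`F` further legs constrained `≤ N(m', F)`; then in every degree `r`, one output label pinned and the output labels of the slots `j ∈ J`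
constrained to `A j`, `Σ_W ‖kernel_r (e^{Δ_C} H) (W)‖ ≤ Σ_{m' ≤ |Γ|/2, r ≤ 2m'} (r!)⁻¹ (∏_{j∉J}(2m'-j)) (2m')^{|J|} κ^{2m'-r} N(m', |J|)`.
[cite: BenfattoGiulianiMastropietro2006, (2.77)-(2.80) and Lemma 2.6] -/
theorem sum_norm_kernel_gaussConv_le_binomial_prescribed_of_gramBounded {κ : ℝ} (hκ : 0 ≤ κ) (hGB : IsGramBoundedR C κ)
    (H : GrassmannAlgebra 𝕜 Γ) (hH : H ∈ evenPart 𝕜 Γ) {r : ℕ} (J : Finset (Fin r)) (A : Fin r → Γ → Bool)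
    (N : ℕ → ℕ → ℝ) (hN0 : ∀ m' F, 0 ≤ N m' F)
    (hN : ∀ (m' : ℕ) (T : Finset (Fin r)), T ⊆ J → ∀ (ι : T → Fin (2 * m')), Function.Injective ι →
      ∀ (t : Fin (2 * m')), (∀ j, ι j ≠ t) → ∀ a : Γ,
        ∑ Y ∈ univ.filter (fun Y : Fin (2 * m') → Γ => Y t = a),
          ‖kernel 𝕜 H (2 * m') Y‖ * ∏ j : T, (if A j (Y (ι j)) = true then (1 : ℝ) else 0) ≤ N m' T.card)
    (i : Fin r) (hi : i ∉ J) (w : Γ) :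
    ∑ W ∈ univ.filter (fun W : Fin r → Γ => W i = w ∧ ∀ j ∈ J, A j (W j) = true), ‖kernel 𝕜 (gaussConv 𝕜 C H) r W‖ ≤
      ∑ m' ∈ range (Fintype.card Γ / 2 + 1), if r ≤ 2 * m' then
        (((r.factorial : ℝ))⁻¹ * ((∏ j ∈ univ.filter (fun j : Fin r => j ∉ J), (2 * m' - (j : ℕ)) : ℕ) : ℝ)) *
          ((2 * m' : ℕ) : ℝ) ^ J.card * κ ^ (2 * m' - r) * N m' J.card else 0 := by
  -- `H` presented by its even kernels
  set X : evenPart 𝕜 Γ := ⟨H, hH⟩ with hX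
  set degs : Finset ℕ := range (Fintype.card Γ / 2 + 1) with hdegs
  set K : (m' : ℕ) → (Fin (2 * m') → Γ) → 𝕜 := fun m' => kernel 𝕜 H (2 * m') with hK
  have hXv : vertexOf 𝕜 degs K = X := Subtype.ext (coe_vertexOf_kernel_eq 𝕜 X)
  -- a (crude) bound on the row and column sums of `‖C‖`: they only enter the tree factor, which is sent to `1`
  set α₀ : ℝ := ∑ A', ∑ B, ‖C A' B‖ with hα₀
  have hα₀0 : 0 ≤ α₀ := sum_nonneg fun A' _ => sum_nonneg fun B _ => norm_nonneg _
  have hrow : ∀ A', ∑ B, ‖C A' B‖ ≤ α₀ := fun A' =>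
    single_le_sum (f := fun A' => ∑ B, ‖C A' B‖) (fun A' _ => sum_nonneg fun B _ => norm_nonneg _) (mem_univ A')
  have hcol : ∀ B, ∑ A', ‖C A' B‖ ≤ α₀ := fun B => by
    rw [hα₀, sum_comm]
    exact single_le_sum (f := fun B => ∑ A', ‖C A' B‖) (fun B _ => sum_nonneg fun A' _ => norm_nonneg _) (mem_univ B)
  -- the terms of the claimed bound, and of its `λ`-perturbation
  set T : ℕ → ℝ := fun m' => if r ≤ 2 * m' then
    (((r.factorial : ℝ))⁻¹ * ((∏ j ∈ univ.filter (fun j : Fin r => j ∉ J), (2 * m' - (j : ℕ)) : ℕ) : ℝ)) *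
      ((2 * m' : ℕ) : ℝ) ^ J.card * κ ^ (2 * m' - r) * N m' J.card else 0 with hT
  set D : ℕ → ℝ := fun m' => α₀ * ((2 * m') * (2 * m') : ℕ) with hD
  have hT0 : ∀ m', 0 ≤ T m' := fun m' => by
    simp only [hT]
    split_ifs
    · exact mul_nonneg (mul_nonneg (mul_nonneg (mul_nonneg (inv_nonneg.2 (Nat.cast_nonneg _)) (Nat.cast_nonneg _))
        (pow_nonneg (Nat.cast_nonneg _) _)) (pow_nonneg hκ _)) (hN0 _ _)
    · exact le_rfl
  have hD0 : ∀ m', 0 ≤ D m' := fun m' => mul_nonneg hα₀0 (Nat.cast_nonneg _)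
  -- the first prescribed cumulant bound, for every `λ = t > 0`
  have key : ∀ t : ℝ, 0 < t →
      ∑ W ∈ univ.filter (fun W : Fin r → Γ => W i = w ∧ ∀ j ∈ J, A j (W j) = true), ‖kernel 𝕜 (gaussConv 𝕜 C H) r W‖ ≤
        ∑ m' ∈ degs, T m' + t * ∑ m' ∈ degs, T m' * D m' := by
    intro t ht
    have h := sum_norm_kernel_cumulantOf_le_prescribed_of_gramBounded C hκ hGB degs K J A N hN0 (fun m' => hN m') hα₀0 hrow hcol
      (fun _ => t) (fun _ => ht) one_pos i hi w
    have hcum : ((cumulantOf (fun k => evenGaussConv 𝕜 C (vertexOf 𝕜 degs K ^ k)) 1 : evenPart 𝕜 Γ) : GrassmannAlgebra 𝕜 Γ) =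
        gaussConv 𝕜 C H := by
      rw [cumulantOf_one, pow_one, hXv, coe_evenGaussConv]
    rw [hcum, Nat.cast_one, one_mul] at h
    refine h.trans ?_
    -- each degree assignment `δ : Fin 1 → ℕ` is `fun _ => δ 0`
    have hterm : ∀ δ ∈ Fintype.piFinset (fun _ : Fin 1 => degs),
        (if r + 2 * (1 - 1) ≤ ∑ a, 2 * δ a then
          ((((r.factorial : ℝ))⁻¹ * ((∏ j ∈ univ.filter (fun j : Fin r => j ∉ J), ((∑ a, 2 * δ a) - (j : ℕ)) : ℕ) : ℝ)) *
              κ ^ ((∑ a, 2 * δ a) - (r + 2 * (1 - 1))) *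
              ∑ pf : J → Fin 1, (∏ j, ((2 * δ (pf j) : ℕ) : ℝ)) * ∏ a, N (δ a) (univ.filter fun j : J => pf j = a).card) *
            ((t)⁻¹ ^ (1 - 1) * ∏ ℓ : Sym2 (Fin 1), (1 + t * (α₀ * (pairDeg (fun a => 2 * δ a) ℓ : ℝ))))
          else 0) = T (δ 0) * (1 + t * D (δ 0)) := by
      intro δ _
      obtain ⟨m', hm'⟩ : ∃ m', δ = fun _ => m' := ⟨δ 0, funext fun a => congrArg δ (Subsingleton.elim a 0)⟩
      subst hm'
      rw [prescribedBound_one]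
      simp only [Fin.sum_univ_one, Nat.sub_self, mul_zero, add_zero, hT, hD]
      split_ifs with hle
      · rfl
      · rw [zero_mul]
    rw [sum_congr rfl hterm]
    -- reindex by `m' = δ 0`
    have hre : ∑ δ ∈ Fintype.piFinset (fun _ : Fin 1 => degs), T (δ 0) * (1 + t * D (δ 0)) =
        ∑ m' ∈ degs, T m' * (1 + t * D m') := by
      refine sum_nbij' (fun δ => δ 0) (fun m' _ => m') ?_ ?_ ?_ ?_ ?_
      · intro δ hδ
        exact (Fintype.mem_piFinset.1 (mem_coe.1 hδ)) 0
      · intro m' hm'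
        exact Fintype.mem_piFinset.2 fun _ => mem_coe.1 hm'
      · intro δ _
        exact funext fun a => congrArg δ (Subsingleton.elim 0 a)
      · intro m' _
        rfl
      · intro δ _
        rfl
    rw [hre]
    refine le_of_eq ?_
    rw [mul_sum, ← sum_add_distrib]
    exact sum_congr rfl fun m' _ => by ring
  -- `λ → 0`
  refine le_of_forall_pos_le_add fun ε hε => ?_
  set B₁ : ℝ := ∑ m' ∈ degs, T m' * D m' with hB₁
  have hB₁0 : 0 ≤ B₁ := sum_nonneg fun m' _ => mul_nonneg (hT0 m') (hD0 m')
  have ht : 0 < ε / (B₁ + 1) := div_pos hε (by linarith)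
  have hkey := key _ ht
  have hmul : ε / (B₁ + 1) * B₁ ≤ ε := by
    rw [div_mul_eq_mul_div, div_le_iff₀ (by linarith)]
    nlinarith
  linarith

omit [Fintype Γ] [DecidableEq Γ] in
/-- The kernels are additive: `kernel (F - G) = kernel F - kernel G`. [folklore] -/
private theorem kernel_sub_aux' (F G : GrassmannAlgebra 𝕜 Γ) (m : ℕ) (X : Fin m → Γ) :
    kernel 𝕜 (F - G) m X = kernel 𝕜 F m X - kernel 𝕜 G m X := by
  rw [sub_eq_add_neg, kernel_add, show -G = (-1 : 𝕜) • G from (neg_one_smul 𝕜 G).symm, kernel_smul]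
  ring

/-! ### The linear part minus the identity, prescribed output legs -/

/-- **`e^{Δ_C} H - H` in binomial–Gram form with prescribed output legs**: in an even degree `2p` only the HIGHER kernels of `H`
contribute, by self-contraction, each with `|J|` legs constrained and one pinned:
`Σ_W ‖kernel_{2p} (e^{Δ_C} H - H) (W)‖ ≤ Σ_{p < m' ≤ |Γ|/2} ((2p)!)⁻¹ (∏_{j∉J}(2m'-j)) (2m')^{|J|} κ^{2m'-2p} N(m', |J|)`.
[cite: BenfattoGiulianiMastropietro2006, (2.61)-(2.63), (2.66) and Lemma 2.6] -/
theorem sum_norm_kernel_gaussConv_sub_le_binomial_prescribed_of_gramBounded {κ : ℝ} (hκ : 0 ≤ κ) (hGB : IsGramBoundedR C κ)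
    (H : GrassmannAlgebra 𝕜 Γ) (hH : H ∈ evenPart 𝕜 Γ) {p : ℕ} (J : Finset (Fin (2 * p))) (A : Fin (2 * p) → Γ → Bool)
    (N : ℕ → ℕ → ℝ) (hN0 : ∀ m' F, 0 ≤ N m' F)
    (hN : ∀ (m' : ℕ) (T : Finset (Fin (2 * p))), T ⊆ J → ∀ (ι : T → Fin (2 * m')), Function.Injective ι →
      ∀ (t : Fin (2 * m')), (∀ j, ι j ≠ t) → ∀ a : Γ,
        ∑ Y ∈ univ.filter (fun Y : Fin (2 * m') → Γ => Y t = a),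
          ‖kernel 𝕜 H (2 * m') Y‖ * ∏ j : T, (if A j (Y (ι j)) = true then (1 : ℝ) else 0) ≤ N m' T.card)
    (i : Fin (2 * p)) (hi : i ∉ J) (w : Γ) :
    ∑ W ∈ univ.filter (fun W : Fin (2 * p) → Γ => W i = w ∧ ∀ j ∈ J, A j (W j) = true),
        ‖kernel 𝕜 (gaussConv 𝕜 C H - H) (2 * p) W‖ ≤
      ∑ m' ∈ range (Fintype.card Γ / 2 + 1), if p < m' then
        ((((2 * p).factorial : ℝ))⁻¹ * ((∏ j ∈ univ.filter (fun j : Fin (2 * p) => j ∉ J), (2 * m' - (j : ℕ)) : ℕ) : ℝ)) *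
          ((2 * m' : ℕ) : ℝ) ^ J.card * κ ^ (2 * m' - 2 * p) * N m' J.card else 0 := by
  -- the degree-`2p` part of `H` and the rest
  set Hp : GrassmannAlgebra 𝕜 Γ := presented 𝕜 (kernel 𝕜 H (2 * p)) with hHp
  have hHp_even : Hp ∈ evenPart 𝕜 Γ := by
    have hcoe : Hp = ((∑ Y : Fin (2 * p) → Γ, kernel 𝕜 H (2 * p) Y • evenGenProd (even_two_mul p) Y : evenPart 𝕜 Γ) :
        GrassmannAlgebra 𝕜 Γ) := by
      rw [hHp, AddSubmonoidClass.coe_finsetSum, presented]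
      exact sum_congr rfl fun Y _ => by rw [Subalgebra.coe_smul, coe_evenGenProd]
    rw [hcoe]
    exact Subtype.mem _
  set H' : GrassmannAlgebra 𝕜 Γ := H - Hp with hH'
  have hH'even : H' ∈ evenPart 𝕜 Γ := sub_mem hH hHp_even
  -- kernels of `Hp` and `H'`
  have hkerHp_top : ∀ Y : Fin (2 * p) → Γ, kernel 𝕜 Hp (2 * p) Y = kernel 𝕜 H (2 * p) Y := fun Y => by
    rw [hHp, kernel_presented_kernel]
  have hkerHp_ne : ∀ {n : ℕ}, n ≠ 2 * p → ∀ Y : Fin n → Γ, kernel 𝕜 Hp n Y = 0 := fun hn Y => by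
    rw [hHp, kernel_presented_of_ne 𝕜 _ Y hn]
  have hkerH'_top : ∀ Y : Fin (2 * p) → Γ, kernel 𝕜 H' (2 * p) Y = 0 := fun Y => by
    rw [hH', kernel_sub_aux', hkerHp_top, sub_self]
  have hkerH'_ne : ∀ {m' : ℕ}, m' ≠ p → ∀ Y : Fin (2 * m') → Γ, kernel 𝕜 H' (2 * m') Y = kernel 𝕜 H (2 * m') Y :=
    fun {m'} hm' Y => by
    rw [hH', kernel_sub_aux', hkerHp_ne (by omega), sub_zero]
  -- (1) the degree-`2p` kernel of `e^{Δ_C} Hp - Hp` vanishes (nothing higher to contract)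
  obtain ⟨k, hk⟩ := isNilpotent_grassmannLaplacian 𝕜 C
  set s : ℝ := ∑ A', ∑ B, ‖C A' B‖ with hs
  have hsC : ∀ A' B, ‖C A' B‖ ≤ s := fun A' B =>
    (single_le_sum (f := fun B => ‖C A' B‖) (fun B _ => norm_nonneg _) (mem_univ B)).trans
      (single_le_sum (f := fun A' => ∑ B, ‖C A' B‖) (fun A' _ => sum_nonneg fun B _ => norm_nonneg _) (mem_univ A'))
  set NP : ℕ → ℝ := fun n => if n = 2 * p then N p 0 else 0 with hNPdef
  have hNplain : ∀ (q : Fin (2 * p)) (w' : Γ), ∑ Z ∈ univ.filter (fun Z : Fin (2 * p) → Γ => Z q = w'),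
      ‖kernel 𝕜 H (2 * p) Z‖ ≤ N p 0 := by
    intro q w'
    have h := hN p ∅ (empty_subset _) (fun j => (notMem_empty _ j.2).elim) (fun j => (notMem_empty _ j.2).elim) q
      (fun j => (notMem_empty _ j.2).elim) w'
    simpa using h
  have hNP : ∀ (n : ℕ) (q : Fin n) (w' : Γ), ∑ Z ∈ univ.filter (fun Z : Fin n → Γ => Z q = w'),
      ‖kernel 𝕜 Hp n Z‖ ≤ NP n := by
    intro n q w'
    by_cases hn : n = 2 * p
    · subst hn
      simp only [hNPdef, if_true, hkerHp_top]
      exact hNplain q w'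
    · simp only [hNPdef, if_neg hn, hkerHp_ne hn, norm_zero, sum_const_zero, le_refl]
  have hvan : ∀ W : Fin (2 * p) → Γ, kernel 𝕜 (gaussConv 𝕜 C Hp - Hp) (2 * p) W = 0 := by
    intro W
    have h := sum_norm_kernel_gaussConv_sub_le C hk hsC Hp NP hNP (2 * p) i (W i)
    have hzero : ∑ j ∈ Ico 1 k, ((2 * p + 2 * j)! : ℝ) / (((2 * p) ! : ℝ) * (j ! : ℝ) * 2 ^ j) * s ^ j * NP (2 * p + 2 * j) = 0 :=
      sum_eq_zero fun j hj => by
        have hj1 : 1 ≤ j := (mem_Ico.1 hj).1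
        rw [hNPdef]
        dsimp only
        rw [if_neg (by omega), mul_zero]
    rw [hzero] at h
    have hmem : W ∈ univ.filter (fun Z : Fin (2 * p) → Γ => Z i = W i) := mem_filter.2 ⟨mem_univ _, rfl⟩
    have h' := (sum_eq_zero_iff_of_nonneg fun Z _ => norm_nonneg _).1
      (le_antisymm h (sum_nonneg fun Z _ => norm_nonneg _)) W hmem
    exact norm_eq_zero.1 h'
  -- (2) hence the degree-`2p` kernel of `e^{Δ_C} H - H` is that of `e^{Δ_C} H'`
  have hsplit : ∀ W : Fin (2 * p) → Γ, kernel 𝕜 (gaussConv 𝕜 C H - H) (2 * p) W = kernel 𝕜 (gaussConv 𝕜 C H') (2 * p) W := by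
    intro W
    have hdec : gaussConv 𝕜 C H - H = gaussConv 𝕜 C H' + (gaussConv 𝕜 C Hp - Hp) - H' := by
      rw [hH', map_sub]
      abel
    rw [hdec, kernel_sub_aux', kernel_add, hvan W, hkerH'_top W, add_zero, sub_zero]
  -- (3) the prescribed binomial–Gram bound for `H'`, whose degree-`2p` kernel vanishes
  set N' : ℕ → ℕ → ℝ := fun m' F => if m' = p then 0 else N m' F with hN'
  have hN'0 : ∀ m' F, 0 ≤ N' m' F := fun m' F => by simp only [hN']; split_ifs; exacts [le_rfl, hN0 m' F]
  have hN'H : ∀ (m' : ℕ) (T : Finset (Fin (2 * p))), T ⊆ J → ∀ (ι : T → Fin (2 * m')), Function.Injective ι →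
      ∀ (t : Fin (2 * m')), (∀ j, ι j ≠ t) → ∀ a : Γ,
        ∑ Y ∈ univ.filter (fun Y : Fin (2 * m') → Γ => Y t = a),
          ‖kernel 𝕜 H' (2 * m') Y‖ * ∏ j : T, (if A j (Y (ι j)) = true then (1 : ℝ) else 0) ≤ N' m' T.card := by
    intro m' T hT ι hι t ht a
    by_cases hm' : m' = p
    · subst hm'
      simp only [hN', if_true, hkerH'_top, norm_zero, zero_mul, sum_const_zero, le_refl]
    · simp only [hN', if_neg hm', hkerH'_ne hm']
      exact hN m' T hT ι hι t ht a
  have h := sum_norm_kernel_gaussConv_le_binomial_prescribed_of_gramBounded C hκ hGB H' hH'even J A N' hN'0 hN'H i hi w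
  rw [sum_congr rfl fun W _ => by rw [hsplit W]]
  refine h.trans (sum_le_sum fun m' _ => ?_)
  simp only [hN']
  by_cases hm' : m' = p
  · subst hm'
    simp
  · by_cases hlt : p < m'
    · rw [if_pos (by omega), if_neg hm', if_pos hlt]
    · have hgt : ¬ 2 * p ≤ 2 * m' := by omega
      rw [if_neg hgt, if_neg hlt]

end Literature.MathematicalPhysics.QuantumLattice
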